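import Summits.QuantumFields.BalabanUV.Beta.GAN24.FineReadoutCauchyMatched

/-!
# `BalabanUV.Beta.GAN24.FineReadoutCauchyMatchedRate` — binder row G-an2-4 / (CONV-C), S-slot located remainder «E3SupRate», located leaf «(N1-Cauchy)»,
# PART A «matched sub-alias», part 3b: THE DISPLAYED CONSTANTS COLLAPSE TO `K_A·(1 + ρ)/N · WS(P)·|q|²/ρ²`
# (one derivative — King exponent `α ↦ α + 1` — is all the two-level comparison costs)

NOT IN PRINT; OUR PROOF ATTEMPT (of the road; THIS file is [folklore] real-number bookkeeping over parts 2–3a; no cited fact, no wall binder,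
no `def … : Prop`; three `def`s = displayed real constants).  HONEST FRAMING (cell contract, verbatim): «discharging `BetaPertH` makes Bałaban's UV
stability UNCONDITIONAL — a real constructive-QFT result; it is NOT the continuum limit and NOT the Clay problem.»  HONEST DEPENDENCY (verbatim):
«continuum YM on T⁴ ⇐ BetaPertH ∧ nine spine estimates (0/9 proved); BetaPertH ⇐ (D1) ∧ (D4) ∧ CAP+tail; G-an2-4 gates asym, D1 and NE2/3/4.»
Discharges NOTHING of (hS, hSall) / «E3SupRate» / «(N1-Cauchy)»; NOT `BetaPertH`, NOT continuum, NOT Clay.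

## What is proved (generic `D`; `1 ≤ N ≤ N′`; real `pr` with `|pr_i| ≤ π`, `pr ≠ 0`; label `P = qlab pr m`, `s = √momSq pr`, `ρ = √momSq P`)
* §1 unit inequalities in the variables `(s, ρ, N)` under `0 < s ≤ ρ ≤ (5π√D/3)·N`, `s² ≤ Dπ²`, `1 ≤ N`: every monomial of parts 2–3a is
  `≤ const · X`, `X := (1 + ρ)/N · s²/ρ²`.
* §2 `inB_cap_le`: `inB ρ (qn pr) (cPP·s²) (cPc·s³) ≤ KB D · s²/ρ²` (`KB = 18cPP + 648·D·cPP + 1296·cPc`); `inR_cap_le`: `inR … ≤ KAR D · X`;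
  `head_le`: `(6/N)·(Σ_i max 12 |P_i|)·inB ≤ 72·D·KB·X`.
* §3 **`norm_ampT_le_KB`** ((A-bound) collapsed: `‖Ã_N(m)‖ ≤ KB·WS(P)·s²/ρ²`) and **`norm_ampT_lift_sub_le_KA`** ((A-rate) collapsed):
  `‖Ã_{N′}(lift N′ m)_κ − Ã_N(m)_κ‖ ≤ KA D · (1 + ρ)/N · WS(P)·s²/ρ²`, `KA = 72·D·KB + KAR`, EVERY alias class `m`, every `1 ≤ N ≤ N′`.
Part 3c (`GAN24/FineReadoutCauchyMatchedSum`): the Lc-cell factor and the N-uniform alias sum.  Unit `b2b-balaban-gan24-formalise-leaf-16` (gen 9), 2026-08-20.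
-/

noncomputable section

open Complex Finset
open scoped BigOperators Real

namespace Summit.QuantumFields.BalabanUV.Beta.GAN24.FineReadoutCauchyMatchedRate

open Literature.Probability.LatticeModels (TorusSite)
open Literature.MathematicalPhysics.QuantumFieldTheory.King1986 (momSq momSq_nonneg)
open Summit.QuantumFields.BalabanUV.Beta.GAN24.AliasReindex (lift)
open Summit.QuantumFields.BalabanUV.Beta.GAN24.FibreRateTBlock (qlab)
open Summit.QuantumFields.BalabanUV.Beta.GAN24.CapacitanceEndpointBlocks (cPP cPc cPP_pos cPc_pos)
open Summit.QuantumFields.BalabanUV.Beta.GAN24.CapacitanceRateScaled (crPP crPc)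
open Summit.QuantumFields.BalabanUV.Beta.GAN24.CapacitanceScalarBounds (momSq_pos)
open Summit.QuantumFields.BalabanUV.Beta.GAN24.FineReadoutCauchyScalars
open Summit.QuantumFields.BalabanUV.Beta.GAN24.FineReadoutCauchyAmp
open Summit.QuantumFields.BalabanUV.Beta.GAN24.FineReadoutCauchyMatched

variable {D : ℕ}

/-! ## §1 Unit inequalities -/

section Units

variable {s ρ Nr c : ℝ}

/-- [folklore] `s³/ρ³ ≤ s²/ρ²` for `0 ≤ s ≤ ρ`, `0 < ρ`. -/
theorem cube_ratio_le (hs : 0 ≤ s) (hsρ : s ≤ ρ) (hρ : 0 < ρ) : s ^ 3 / ρ ^ 3 ≤ s ^ 2 / ρ ^ 2 := by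
  have hρ2 : 0 < ρ ^ 2 := pow_pos hρ 2
  rw [div_le_div_iff₀ (pow_pos hρ 3) hρ2, show s ^ 3 * ρ ^ 2 = (s ^ 2 * ρ ^ 2) * s by ring,
    show s ^ 2 * ρ ^ 3 = (s ^ 2 * ρ ^ 2) * ρ by ring]
  exact mul_le_mul_of_nonneg_left hsρ (mul_nonneg (pow_nonneg hs 2) hρ2.le)

/-- [folklore] `t/N ≤ (1+ρ)/N·t` for `t, ρ ≥ 0`, `N > 0`. -/
theorem unit_one {t : ℝ} (ht : 0 ≤ t) (hρ : 0 ≤ ρ) (hN : 0 < Nr) : t / Nr ≤ (1 + ρ) / Nr * t := by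
  rw [div_mul_eq_mul_div, div_le_div_iff_of_pos_right hN]; nlinarith

/-- [folklore] `t·ρ/N ≤ (1+ρ)/N·t`. -/
theorem unit_rho {t : ℝ} (ht : 0 ≤ t) (hN : 0 < Nr) : t * ρ / Nr ≤ (1 + ρ) / Nr * t := by
  rw [div_mul_eq_mul_div, div_le_div_iff_of_pos_right hN]; nlinarith

/-- [folklore] `t·ρ²/N² ≤ c·(1+ρ)/N·t` when `ρ ≤ c·N` (`c ≥ 0`). -/
theorem unit_rho_sq {t : ℝ} (ht : 0 ≤ t) (hρ : 0 ≤ ρ) (hN : 0 < Nr) (hρN : ρ ≤ c * Nr) :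
    t * ρ ^ 2 / Nr ^ 2 ≤ c * ((1 + ρ) / Nr * t) := by
  have h1 : t * ρ ^ 2 / Nr ^ 2 = (t * ρ / Nr) * (ρ / Nr) := by field_simp
  have h2 : ρ / Nr ≤ c := by rw [div_le_iff₀ hN]; exact hρN
  rw [h1]
  calc (t * ρ / Nr) * (ρ / Nr) ≤ ((1 + ρ) / Nr * t) * (ρ / Nr) :=
        mul_le_mul_of_nonneg_right (unit_rho ht hN) (by positivity)
    _ ≤ ((1 + ρ) / Nr * t) * c := mul_le_mul_of_nonneg_left h2 (by positivity)
    _ = c * ((1 + ρ) / Nr * t) := by ring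

/-- [folklore] `t·s²/N² ≤ B·(1+ρ)/N·t` when `s² ≤ B`, `N ≥ 1`. -/
theorem unit_s_sq {t B : ℝ} (ht : 0 ≤ t) (hρ : 0 ≤ ρ) (hN : 1 ≤ Nr) (hsB : s ^ 2 ≤ B) :
    t * s ^ 2 / Nr ^ 2 ≤ B * ((1 + ρ) / Nr * t) := by
  have hN0 : 0 < Nr := by linarith
  have hB : 0 ≤ B := (sq_nonneg s).trans hsB
  have h1 : t * s ^ 2 / Nr ^ 2 ≤ t * B / Nr ^ 2 := by gcongr
  have h2 : t * B / Nr ^ 2 ≤ t * B / Nr :=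
    div_le_div_of_nonneg_left (mul_nonneg ht hB) hN0 (by nlinarith)
  have h3 : t * B / Nr ≤ B * ((1 + ρ) / Nr * t) := by
    rw [show t * B / Nr = B * (t / Nr) by ring]
    exact mul_le_mul_of_nonneg_left (unit_one ht hρ hN0) hB
  linarith

/-! ### The nine terms of `inR` in unit form (all-real variables; `X = (1+ρ)/N·s²/ρ²`) -/

/-- [folklore] Term 1: `108/N²·Φ`, `Φ = cP·s²`. -/
theorem term1_le {cP : ℝ} (hcP : 0 ≤ cP) (hs : 0 < s) (hρ : 0 < ρ) (hN : 0 < Nr) (hρN : ρ ≤ c * Nr) :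
    108 / Nr ^ 2 * 1 * (cP * s ^ 2) ≤ 108 * cP * c * ((1 + ρ) / Nr * (s ^ 2 / ρ ^ 2)) := by
  have h := unit_rho_sq (t := s ^ 2 / ρ ^ 2) (by positivity) hρ.le hN hρN
  have e : 108 / Nr ^ 2 * 1 * (cP * s ^ 2) = 108 * cP * (s ^ 2 / ρ ^ 2 * ρ ^ 2 / Nr ^ 2) := by field_simp
  rw [e, show 108 * cP * c * ((1 + ρ) / Nr * (s ^ 2 / ρ ^ 2)) = 108 * cP * (c * ((1 + ρ) / Nr * (s ^ 2 / ρ ^ 2))) by ring]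
  exact mul_le_mul_of_nonneg_left h (by positivity)

/-- [folklore] Term 2: `(18/ρ²)(72/N)·Φ`. -/
theorem term2_le {cP : ℝ} (hcP : 0 ≤ cP) (hs : 0 < s) (hρ : 0 < ρ) (hN : 0 < Nr) :
    18 / ρ ^ 2 * (72 / Nr) * (cP * s ^ 2) ≤ 1296 * cP * ((1 + ρ) / Nr * (s ^ 2 / ρ ^ 2)) := by
  have h := unit_one (t := s ^ 2 / ρ ^ 2) (by positivity) hρ.le hN
  have e : 18 / ρ ^ 2 * (72 / Nr) * (cP * s ^ 2) = 1296 * cP * (s ^ 2 / ρ ^ 2 / Nr) := by field_simp; ring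
  rw [e]
  exact mul_le_mul_of_nonneg_left h (by positivity)

/-- [folklore] Term 3: `(18/ρ²)·dΦ`, `dΦ = rP·s⁴/N²`, `s² ≤ B`. -/
theorem term3_le {rP B : ℝ} (hrP : 0 ≤ rP) (hs : 0 < s) (hρ : 0 < ρ) (hN : 1 ≤ Nr) (hsB : s ^ 2 ≤ B) :
    18 / ρ ^ 2 * 1 * (rP * (s ^ 2) ^ 2 / Nr ^ 2) ≤ 18 * rP * B * ((1 + ρ) / Nr * (s ^ 2 / ρ ^ 2)) := by
  have hN0 : 0 < Nr := by linarith
  have h := unit_s_sq (t := s ^ 2 / ρ ^ 2) (by positivity) hρ.le hN hsB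
  have e : 18 / ρ ^ 2 * 1 * (rP * (s ^ 2) ^ 2 / Nr ^ 2) = 18 * rP * (s ^ 2 / ρ ^ 2 * s ^ 2 / Nr ^ 2) := by field_simp
  rw [e, show 18 * rP * B * ((1 + ρ) / Nr * (s ^ 2 / ρ ^ 2)) = 18 * rP * (B * ((1 + ρ) / Nr * (s ^ 2 / ρ ^ 2))) by ring]
  exact mul_le_mul_of_nonneg_left h (by positivity)

/-- [folklore] Term 4: `279936/(N²ρ²)·ρ·qn·Φ`, `qn ≤ Dr·s`, `s ≤ ρ ≤ c·N`. -/
theorem term4_le {cP qn Dr : ℝ} (hcP : 0 ≤ cP) (hqn0 : 0 ≤ qn) (hqn : qn ≤ Dr * s) (hs : 0 < s) (hsρ : s ≤ ρ) (hN : 0 < Nr)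
    (hρN : ρ ≤ c * Nr) :
    279936 / (Nr ^ 2 * ρ ^ 2) * ρ * (qn * (cP * s ^ 2)) ≤ 279936 * Dr * cP * c * ((1 + ρ) / Nr * (s ^ 2 / ρ ^ 2)) := by
  have hρ : 0 < ρ := lt_of_lt_of_le hs hsρ
  have hD : 0 ≤ Dr := by nlinarith
  have hcube := cube_ratio_le hs.le hsρ hρ
  have h := unit_rho_sq (t := s ^ 2 / ρ ^ 2) (by positivity) hρ.le hN hρN
  calc 279936 / (Nr ^ 2 * ρ ^ 2) * ρ * (qn * (cP * s ^ 2))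
      ≤ 279936 / (Nr ^ 2 * ρ ^ 2) * ρ * ((Dr * s) * (cP * s ^ 2)) := by gcongr
    _ = 279936 * Dr * cP * ((s ^ 3 / ρ ^ 3) * (ρ ^ 2 / Nr ^ 2)) := by field_simp
    _ ≤ 279936 * Dr * cP * ((s ^ 2 / ρ ^ 2) * (ρ ^ 2 / Nr ^ 2)) := by gcongr
    _ = 279936 * Dr * cP * (s ^ 2 / ρ ^ 2 * ρ ^ 2 / Nr ^ 2) := by ring
    _ ≤ 279936 * Dr * cP * (c * ((1 + ρ) / Nr * (s ^ 2 / ρ ^ 2))) := mul_le_mul_of_nonneg_left h (by positivity)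
    _ = 279936 * Dr * cP * c * ((1 + ρ) / Nr * (s ^ 2 / ρ ^ 2)) := by ring

/-- [folklore] Term 5: `(648/ρ⁴)(ρ²/N)·qn·Φ`. -/
theorem term5_le {cP qn Dr : ℝ} (hcP : 0 ≤ cP) (hqn0 : 0 ≤ qn) (hqn : qn ≤ Dr * s) (hs : 0 < s) (hsρ : s ≤ ρ) (hN : 0 < Nr) :
    648 / ρ ^ 4 * (ρ ^ 2 / Nr) * (qn * (cP * s ^ 2)) ≤ 648 * Dr * cP * ((1 + ρ) / Nr * (s ^ 2 / ρ ^ 2)) := by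
  have hρ : 0 < ρ := lt_of_lt_of_le hs hsρ
  have hD : 0 ≤ Dr := by nlinarith
  have hcube := cube_ratio_le hs.le hsρ hρ
  have h := unit_rho (ρ := ρ) (t := s ^ 2 / ρ ^ 2) (by positivity) hN
  calc 648 / ρ ^ 4 * (ρ ^ 2 / Nr) * (qn * (cP * s ^ 2))
      ≤ 648 / ρ ^ 4 * (ρ ^ 2 / Nr) * ((Dr * s) * (cP * s ^ 2)) := by gcongr
    _ = 648 * Dr * cP * ((s ^ 3 / ρ ^ 3) * (ρ / Nr)) := by field_simp
    _ ≤ 648 * Dr * cP * ((s ^ 2 / ρ ^ 2) * (ρ / Nr)) := by gcongr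
    _ = 648 * Dr * cP * (s ^ 2 / ρ ^ 2 * ρ / Nr) := by ring
    _ ≤ 648 * Dr * cP * ((1 + ρ) / Nr * (s ^ 2 / ρ ^ 2)) := mul_le_mul_of_nonneg_left h (by positivity)

/-- [folklore] Term 6: `(648/ρ⁴)·ρ·qn·dΦ`. -/
theorem term6_le {rP qn Dr B : ℝ} (hrP : 0 ≤ rP) (hqn0 : 0 ≤ qn) (hqn : qn ≤ Dr * s) (hs : 0 < s) (hsρ : s ≤ ρ) (hN : 1 ≤ Nr)
    (hsB : s ^ 2 ≤ B) :
    648 / ρ ^ 4 * ρ * (qn * (rP * (s ^ 2) ^ 2 / Nr ^ 2)) ≤ 648 * Dr * rP * B * ((1 + ρ) / Nr * (s ^ 2 / ρ ^ 2)) := by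
  have hρ : 0 < ρ := lt_of_lt_of_le hs hsρ
  have hN0 : 0 < Nr := by linarith
  have hD : 0 ≤ Dr := by nlinarith
  have hcube := cube_ratio_le hs.le hsρ hρ
  have h := unit_s_sq (t := s ^ 2 / ρ ^ 2) (by positivity) hρ.le hN hsB
  calc 648 / ρ ^ 4 * ρ * (qn * (rP * (s ^ 2) ^ 2 / Nr ^ 2))
      ≤ 648 / ρ ^ 4 * ρ * ((Dr * s) * (rP * (s ^ 2) ^ 2 / Nr ^ 2)) := by gcongr
    _ = 648 * Dr * rP * ((s ^ 3 / ρ ^ 3) * (s ^ 2 / Nr ^ 2)) := by field_simp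
    _ ≤ 648 * Dr * rP * ((s ^ 2 / ρ ^ 2) * (s ^ 2 / Nr ^ 2)) := by gcongr
    _ = 648 * Dr * rP * (s ^ 2 / ρ ^ 2 * s ^ 2 / Nr ^ 2) := by ring
    _ ≤ 648 * Dr * rP * (B * ((1 + ρ) / Nr * (s ^ 2 / ρ ^ 2))) := mul_le_mul_of_nonneg_left h (by positivity)
    _ = 648 * Dr * rP * B * ((1 + ρ) / Nr * (s ^ 2 / ρ ^ 2)) := by ring

/-- [folklore] Term 7: `559872/(N²ρ²)·ρ·Cc`, `Cc = cC·s³`. -/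
theorem term7_le {cC : ℝ} (hcC : 0 ≤ cC) (hs : 0 < s) (hsρ : s ≤ ρ) (hN : 0 < Nr) (hρN : ρ ≤ c * Nr) :
    559872 / (Nr ^ 2 * ρ ^ 2) * ρ * (cC * (s ^ 2 * s)) ≤ 559872 * cC * c * ((1 + ρ) / Nr * (s ^ 2 / ρ ^ 2)) := by
  have hρ : 0 < ρ := lt_of_lt_of_le hs hsρ
  have hcube := cube_ratio_le hs.le hsρ hρ
  have h := unit_rho_sq (t := s ^ 2 / ρ ^ 2) (by positivity) hρ.le hN hρN
  calc 559872 / (Nr ^ 2 * ρ ^ 2) * ρ * (cC * (s ^ 2 * s))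
      = 559872 * cC * ((s ^ 3 / ρ ^ 3) * (ρ ^ 2 / Nr ^ 2)) := by field_simp
    _ ≤ 559872 * cC * ((s ^ 2 / ρ ^ 2) * (ρ ^ 2 / Nr ^ 2)) := by gcongr
    _ = 559872 * cC * (s ^ 2 / ρ ^ 2 * ρ ^ 2 / Nr ^ 2) := by ring
    _ ≤ 559872 * cC * (c * ((1 + ρ) / Nr * (s ^ 2 / ρ ^ 2))) := mul_le_mul_of_nonneg_left h (by positivity)
    _ = 559872 * cC * c * ((1 + ρ) / Nr * (s ^ 2 / ρ ^ 2)) := by ring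

/-- [folklore] Term 8: `(1296/ρ⁴)(ρ²/N)·Cc`. -/
theorem term8_le {cC : ℝ} (hcC : 0 ≤ cC) (hs : 0 < s) (hsρ : s ≤ ρ) (hN : 0 < Nr) :
    1296 / ρ ^ 4 * (ρ ^ 2 / Nr) * (cC * (s ^ 2 * s)) ≤ 1296 * cC * ((1 + ρ) / Nr * (s ^ 2 / ρ ^ 2)) := by
  have hρ : 0 < ρ := lt_of_lt_of_le hs hsρ
  have hcube := cube_ratio_le hs.le hsρ hρ
  have h := unit_rho (ρ := ρ) (t := s ^ 2 / ρ ^ 2) (by positivity) hN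
  calc 1296 / ρ ^ 4 * (ρ ^ 2 / Nr) * (cC * (s ^ 2 * s))
      = 1296 * cC * ((s ^ 3 / ρ ^ 3) * (ρ / Nr)) := by field_simp
    _ ≤ 1296 * cC * ((s ^ 2 / ρ ^ 2) * (ρ / Nr)) := by gcongr
    _ = 1296 * cC * (s ^ 2 / ρ ^ 2 * ρ / Nr) := by ring
    _ ≤ 1296 * cC * ((1 + ρ) / Nr * (s ^ 2 / ρ ^ 2)) := mul_le_mul_of_nonneg_left h (by positivity)

/-- [folklore] Term 9: `(1296/ρ⁴)·ρ·dC`, `dC = rC·s⁵/N²`. -/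
theorem term9_le {rC B : ℝ} (hrC : 0 ≤ rC) (hs : 0 < s) (hsρ : s ≤ ρ) (hN : 1 ≤ Nr) (hsB : s ^ 2 ≤ B) :
    1296 / ρ ^ 4 * ρ * (rC * ((s ^ 2) ^ 2 * s) / Nr ^ 2) ≤ 1296 * rC * B * ((1 + ρ) / Nr * (s ^ 2 / ρ ^ 2)) := by
  have hρ : 0 < ρ := lt_of_lt_of_le hs hsρ
  have hN0 : 0 < Nr := by linarith
  have hcube := cube_ratio_le hs.le hsρ hρ
  have h := unit_s_sq (t := s ^ 2 / ρ ^ 2) (by positivity) hρ.le hN hsB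
  calc 1296 / ρ ^ 4 * ρ * (rC * ((s ^ 2) ^ 2 * s) / Nr ^ 2)
      = 1296 * rC * ((s ^ 3 / ρ ^ 3) * (s ^ 2 / Nr ^ 2)) := by field_simp
    _ ≤ 1296 * rC * ((s ^ 2 / ρ ^ 2) * (s ^ 2 / Nr ^ 2)) := by gcongr
    _ = 1296 * rC * (s ^ 2 / ρ ^ 2 * s ^ 2 / Nr ^ 2) := by ring
    _ ≤ 1296 * rC * (B * ((1 + ρ) / Nr * (s ^ 2 / ρ ^ 2))) := mul_le_mul_of_nonneg_left h (by positivity)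
    _ = 1296 * rC * B * ((1 + ρ) / Nr * (s ^ 2 / ρ ^ 2)) := by ring

end Units

/-! ## §2 The displayed bound and rate, collapsed -/

/-- The collapsed BOUND constant `KB D = 18·cPP + 648·D·cPP + 1296·cPc`. -/
def KB (D : ℕ) : ℝ := 18 * cPP D + 648 * D * cPP D + 1296 * cPc D

/-- `5π√D/3`: the zone radius per level (`ρ ≤ (5π√D/3)·N`). -/
def c5 (D : ℕ) : ℝ := 5 * π * Real.sqrt D / 3

/-- The collapsed RATE constant of the inner amplitude. -/
def KAR (D : ℕ) : ℝ :=
  108 * cPP D * c5 D + 1296 * cPP D + 18 * crPP D * (D * π ^ 2)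
  + 279936 * D * cPP D * c5 D + 648 * D * cPP D + 648 * D * crPP D * (D * π ^ 2)
  + 559872 * cPc D * c5 D + 1296 * cPc D + 1296 * crPc D * (D * π ^ 2)

/-- The collapsed (A-rate) constant `KA D = 72·D·KB + KAR`. -/
def KA (D : ℕ) : ℝ := 72 * D * KB D + KAR D

/-- [folklore] `0 ≤ KB`. -/
theorem KB_nonneg (D : ℕ) : 0 ≤ KB D := by
  unfold KB; have := (cPP_pos D).le; have := (cPc_pos D).le; positivity

/-- [folklore] `0 ≤ c5`. -/
theorem c5_nonneg (D : ℕ) : 0 ≤ c5 D := by unfold c5; positivity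

/-- [folklore] `0 ≤ KAR` (leaf-20's `crPP_nonneg`/`crPc_nonneg` live in `FibreRateOfLegs`/`FibreRate`, outside this import cone; their
4-line positivity proofs are inlined). -/
theorem KAR_nonneg (D : ℕ) : 0 ≤ KAR D := by
  have hA := CapacitanceRateScaled.rateA_nonneg D
  have hS := CapacitanceRateScaled.rateS_nonneg D
  have hG := (CapacitanceEndpointBlocks.gFac_pos D (by positivity : (0:ℝ) ≤ D * π ^ 2)).le
  have hrP : 0 ≤ crPP D := by unfold CapacitanceRateScaled.crPP; positivity
  have hrC : 0 ≤ crPc D := by unfold CapacitanceRateScaled.crPc; positivity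
  have := (cPP_pos D).le; have := (cPc_pos D).le; have := c5_nonneg D
  unfold KAR; positivity

/-- [folklore] `0 ≤ KA`. -/
theorem KA_nonneg (D : ℕ) : 0 ≤ KA D := by
  have := KB_nonneg D; have := KAR_nonneg D; unfold KA; positivity

section Collapse

variable {N N' : ℕ} [NeZero N] [NeZero N'] {pr : Fin D → ℝ}

/-- [folklore] `s := √momSq pr` dominates every coordinate, hence `qn pr ≤ D·s`. -/
theorem qn_le (pr : Fin D → ℝ) : qn pr ≤ D * Real.sqrt (momSq pr) := by
  unfold qn
  calc ∑ l, |pr l| ≤ ∑ _l : Fin D, Real.sqrt (momSq pr) := Finset.sum_le_sum fun l _ => abs_apply_le_rho pr l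
    _ = D * Real.sqrt (momSq pr) := by rw [Finset.sum_const, Finset.card_univ, Fintype.card_fin, nsmul_eq_mul]

/-- [folklore] The label modulus is at most `(5π√D/3)·N` on the zone. -/
theorem rho_qlab_le (hN : 1 ≤ N) (hq : ∀ i, |pr i| ≤ π) (m : TorusSite D N) : rho (qlab pr m) ≤ c5 D * N := by
  have hz := qlab_zone_one hN hq m
  have hN0 : (0 : ℝ) ≤ N := Nat.cast_nonneg N
  have hπ := Real.pi_pos
  unfold rho c5
  have hsum : momSq (qlab pr m) ≤ D * (5 * π / 3 * N) ^ 2 := by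
    unfold momSq
    calc ∑ i, qlab pr m i ^ 2 ≤ ∑ _i : Fin D, (5 * π / 3 * N) ^ 2 := Finset.sum_le_sum fun i _ => by
          rw [← sq_abs]; exact pow_le_pow_left₀ (abs_nonneg _) (hz i) 2
      _ = D * (5 * π / 3 * N) ^ 2 := by rw [Finset.sum_const, Finset.card_univ, Fintype.card_fin, nsmul_eq_mul]
  calc Real.sqrt (momSq (qlab pr m)) ≤ Real.sqrt (D * (5 * π / 3 * N) ^ 2) := Real.sqrt_le_sqrt hsum
    _ = Real.sqrt D * (5 * π / 3 * N) := by rw [Real.sqrt_mul (Nat.cast_nonneg D), Real.sqrt_sq (by positivity)]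
    _ = 5 * π * Real.sqrt D / 3 * N := by ring

omit [NeZero N] in
/-- [folklore] **THE BOUND COLLAPSED**: `inB ρ (qn pr) (cPP·s²) (cPc·s²·s) ≤ KB·s²/ρ²` (`s³/ρ³ ≤ s²/ρ²` pays the `m = 0` poles). -/
theorem inB_cap_le (hq : ∀ i, |pr i| ≤ π) (hq0 : pr ≠ 0) (m : TorusSite D N) :
    inB (rho (qlab pr m)) (qn pr) (cPP D * momSq pr) (cPc D * (momSq pr * Real.sqrt (momSq pr)))
      ≤ KB D * (momSq pr / momSq (qlab pr m)) := by
  set s := Real.sqrt (momSq pr) with hs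
  set ρ := rho (qlab pr m) with hρdef
  have hs0 : 0 < s := Real.sqrt_pos.2 (momSq_pos hq0)
  have hρ0 : 0 < ρ := rho_pos (qlab_ne_zero hq hq0 m)
  have hss : s ^ 2 = momSq pr := Real.sq_sqrt (momSq_nonneg pr)
  have hρρ : ρ ^ 2 = momSq (qlab pr m) := rho_sq _
  have hsρ : s ≤ ρ := by rw [hs, hρdef, rho]; exact Real.sqrt_le_sqrt (momSq_le_momSq_qlab hq m)
  have hcube := cube_ratio_le hs0.le hsρ hρ0
  have hqn : qn pr ≤ D * s := qn_le pr
  have hqn0 := qn_nonneg pr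
  have hP := (cPP_pos D).le; have hC := (cPc_pos D).le; have hD : (0 : ℝ) ≤ D := Nat.cast_nonneg D
  rw [← hss, ← hρρ]
  unfold inB KB
  have e1 : 18 * (cPP D * s ^ 2) / ρ ^ 2 = 18 * cPP D * (s ^ 2 / ρ ^ 2) := by ring
  have e2 : 648 * qn pr * (cPP D * s ^ 2) / ρ ^ 3 = 648 * cPP D * qn pr * (s ^ 2 / ρ ^ 3) := by ring
  have e3 : 1296 * (cPc D * (s ^ 2 * s)) / ρ ^ 3 = 1296 * cPc D * (s ^ 3 / ρ ^ 3) := by ring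
  rw [e1, e2, e3]
  have h2 : 648 * cPP D * qn pr * (s ^ 2 / ρ ^ 3) ≤ 648 * D * cPP D * (s ^ 2 / ρ ^ 2) := by
    calc 648 * cPP D * qn pr * (s ^ 2 / ρ ^ 3) ≤ 648 * cPP D * (D * s) * (s ^ 2 / ρ ^ 3) := by gcongr
      _ = 648 * D * cPP D * (s ^ 3 / ρ ^ 3) := by ring
      _ ≤ 648 * D * cPP D * (s ^ 2 / ρ ^ 2) := by gcongr
  have h3 : 1296 * cPc D * (s ^ 3 / ρ ^ 3) ≤ 1296 * cPc D * (s ^ 2 / ρ ^ 2) := by gcongr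
  linarith [h2, h3]

/-- [folklore] **THE RATE COLLAPSED**: `inR N ρ (qn pr) (cPP s²) (cPc s³) (crPP s⁴/N²) (crPc s⁵/N²) ≤ KAR·(1+ρ)/N·s²/ρ²`. -/
theorem inR_cap_le (hN : 1 ≤ N) (hq : ∀ i, |pr i| ≤ π) (hq0 : pr ≠ 0) (m : TorusSite D N) :
    inR N (rho (qlab pr m)) (qn pr) (cPP D * momSq pr) (cPc D * (momSq pr * Real.sqrt (momSq pr)))
        (crPP D * momSq pr ^ 2 / (N : ℝ) ^ 2) (crPc D * (momSq pr ^ 2 * Real.sqrt (momSq pr)) / (N : ℝ) ^ 2)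
      ≤ KAR D * ((1 + rho (qlab pr m)) / N * (momSq pr / momSq (qlab pr m))) := by
  set s := Real.sqrt (momSq pr) with hs
  set ρ := rho (qlab pr m) with hρdef
  have hNr : (1 : ℝ) ≤ N := by exact_mod_cast hN
  have hN0 : (0 : ℝ) < N := by linarith
  have hs0 : 0 < s := Real.sqrt_pos.2 (momSq_pos hq0)
  have hρ0 : 0 < ρ := rho_pos (qlab_ne_zero hq hq0 m)
  have hss : s ^ 2 = momSq pr := Real.sq_sqrt (momSq_nonneg pr)
  have hρρ : ρ ^ 2 = momSq (qlab pr m) := rho_sq _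
  have hsρ : s ≤ ρ := by rw [hs, hρdef, rho]; exact Real.sqrt_le_sqrt (momSq_le_momSq_qlab hq m)
  have hsB : s ^ 2 ≤ D * π ^ 2 := by rw [hss]; exact CapacitanceRateScaled.momSq_le hq
  have hρN : ρ ≤ c5 D * N := rho_qlab_le hN hq m
  have hqn : qn pr ≤ D * s := qn_le pr
  have hqn0 := qn_nonneg pr
  have hP := (cPP_pos D).le; have hC := (cPc_pos D).le
  have hG := (CapacitanceEndpointBlocks.gFac_pos D (by positivity : (0:ℝ) ≤ D * π ^ 2)).le
  have hrP : 0 ≤ crPP D := by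
    have := CapacitanceRateScaled.rateA_nonneg D; unfold CapacitanceRateScaled.crPP; positivity
  have hrC : 0 ≤ crPc D := by
    have := CapacitanceRateScaled.rateA_nonneg D; have := CapacitanceRateScaled.rateS_nonneg D
    unfold CapacitanceRateScaled.crPc; positivity
  rw [← hss, ← hρρ]
  unfold inR KAR
  have h1 := term1_le hP hs0 hρ0 hN0 hρN
  have h2 := term2_le hP hs0 hρ0 hN0
  have h3 := term3_le hrP hs0 hρ0 hNr hsB
  have h4 := term4_le hP hqn0 hqn hs0 hsρ hN0 hρN
  have h5 := term5_le hP hqn0 hqn hs0 hsρ hN0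
  have h6 := term6_le hrP hqn0 hqn hs0 hsρ hNr hsB
  have h7 := term7_le hC hs0 hsρ hN0 hρN
  have h8 := term8_le hC hs0 hsρ hN0
  have h9 := term9_le hrC hs0 hsρ hNr hsB
  linarith [h1, h2, h3, h4, h5, h6, h7, h8, h9]

omit [NeZero N] in
/-- [folklore] THE HEAD TERM: `(6/N)·(Σ_i max 12 |P_i|)·inB ≤ 72·D·KB·(1+ρ)/N·s²/ρ²` (`max 12 |P_i| ≤ 12 + ρ ≤ 12(1+ρ)`). -/
theorem head_le (hN : 1 ≤ N) (hq : ∀ i, |pr i| ≤ π) (hq0 : pr ≠ 0) (m : TorusSite D N) :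
    6 / N * (∑ i, max 12 |qlab pr m i|)
        * inB (rho (qlab pr m)) (qn pr) (cPP D * momSq pr) (cPc D * (momSq pr * Real.sqrt (momSq pr)))
      ≤ 72 * D * KB D * ((1 + rho (qlab pr m)) / N * (momSq pr / momSq (qlab pr m))) := by
  set ρ := rho (qlab pr m) with hρdef
  have hN0 : (0 : ℝ) < N := by exact_mod_cast hN
  have hρ0 : 0 < ρ := rho_pos (qlab_ne_zero hq hq0 m)
  have hB := inB_cap_le hq hq0 m
  have hB0 := inB_nonneg (Φ := cPP D * momSq pr) (Cc := cPc D * (momSq pr * Real.sqrt (momSq pr))) hρ0 (qn_nonneg pr)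
    (mul_nonneg (cPP_pos D).le (momSq_nonneg pr)) (mul_nonneg (cPc_pos D).le (mul_nonneg (momSq_nonneg pr) (Real.sqrt_nonneg _)))
  have hmax : ∑ i, max 12 |qlab pr m i| ≤ D * (12 * (1 + ρ)) := by
    calc ∑ i, max 12 |qlab pr m i| ≤ ∑ _i : Fin D, 12 * (1 + ρ) := Finset.sum_le_sum fun i _ => by
          have := abs_apply_le_rho (qlab pr m) i
          exact max_le (by nlinarith) (by nlinarith)
      _ = D * (12 * (1 + ρ)) := by rw [Finset.sum_const, Finset.card_univ, Fintype.card_fin, nsmul_eq_mul]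
  have ht0 : 0 ≤ momSq pr / momSq (qlab pr m) := div_nonneg (momSq_nonneg _) (momSq_nonneg _)
  have hKB := KB_nonneg D; have hD : (0 : ℝ) ≤ D := Nat.cast_nonneg D
  calc 6 / N * (∑ i, max 12 |qlab pr m i|) * inB (rho (qlab pr m)) (qn pr) (cPP D * momSq pr) (cPc D * (momSq pr * Real.sqrt (momSq pr)))
      ≤ 6 / N * (D * (12 * (1 + ρ))) * (KB D * (momSq pr / momSq (qlab pr m))) := by gcongr
    _ = 72 * D * KB D * ((1 + ρ) / N * (momSq pr / momSq (qlab pr m))) := by ring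

/-! ## §3 (A-bound) and (A-rate), collapsed -/

/-- [folklore] **(A-bound), COLLAPSED**: `‖Ã_N(m)_κ‖ ≤ KB·WS(P)·s²/ρ²` — every alias class, every `N ≥ 1`. -/
theorem norm_ampT_le_KB (hN : 1 ≤ N) (hq : ∀ i, |pr i| ≤ π) (hq0 : pr ≠ 0) (l : Fin D) (m : TorusSite D N) (κ : Fin D) :
    ‖ampT N pr l m κ‖ ≤ KB D * (WS (qlab pr m) * (momSq pr / momSq (qlab pr m))) := by
  have h := norm_ampT_le hN hq hq0 l m κ
  have hB := inB_cap_le hq hq0 m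
  have hW := (WS_pos (qlab pr m)).le
  calc ‖ampT N pr l m κ‖ ≤ WS (qlab pr m) * inB (rho (qlab pr m)) (qn pr) (cPP D * momSq pr) (cPc D * (momSq pr * Real.sqrt (momSq pr))) := h
    _ ≤ WS (qlab pr m) * (KB D * (momSq pr / momSq (qlab pr m))) := mul_le_mul_of_nonneg_left hB hW
    _ = KB D * (WS (qlab pr m) * (momSq pr / momSq (qlab pr m))) := by ring

/-- [folklore] **(A-rate), COLLAPSED — THE MATCHED-LABEL TWO-LEVEL RATE COSTS EXACTLY ONE DERIVATIVE**:
`‖Ã_{N′}(lift N′ m)_κ − Ã_N(m)_κ‖ ≤ KA·(1 + ρ)/N·WS(P)·s²/ρ²`, every alias class `m`, every `1 ≤ N ≤ N′`. -/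
theorem norm_ampT_lift_sub_le_KA (hN : 1 ≤ N) (hNN' : N ≤ N') (hq : ∀ i, |pr i| ≤ π) (hq0 : pr ≠ 0) (l : Fin D)
    (m : TorusSite D N) (κ : Fin D) :
    ‖ampT N' pr l (lift N' m) κ - ampT N pr l m κ‖
      ≤ KA D * ((1 + rho (qlab pr m)) / N * (WS (qlab pr m) * (momSq pr / momSq (qlab pr m)))) := by
  have h := norm_ampT_lift_sub_le hN hNN' hq hq0 l m κ
  have hH := head_le hN hq hq0 m
  have hR := inR_cap_le hN hq hq0 m
  have hW := (WS_pos (qlab pr m)).le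
  refine h.trans ?_
  unfold KA
  have e : ∀ a b : ℝ, 6 / N * (∑ i, max 12 |qlab pr m i|) * WS (qlab pr m) * a + WS (qlab pr m) * b
      = WS (qlab pr m) * (6 / N * (∑ i, max 12 |qlab pr m i|) * a + b) := fun a b => by ring
  rw [e]
  calc WS (qlab pr m) * (6 / N * (∑ i, max 12 |qlab pr m i|)
          * inB (rho (qlab pr m)) (qn pr) (cPP D * momSq pr) (cPc D * (momSq pr * Real.sqrt (momSq pr)))
        + inR N (rho (qlab pr m)) (qn pr) (cPP D * momSq pr) (cPc D * (momSq pr * Real.sqrt (momSq pr)))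
            (crPP D * momSq pr ^ 2 / (N : ℝ) ^ 2) (crPc D * (momSq pr ^ 2 * Real.sqrt (momSq pr)) / (N : ℝ) ^ 2))
      ≤ WS (qlab pr m) * (72 * D * KB D * ((1 + rho (qlab pr m)) / N * (momSq pr / momSq (qlab pr m)))
          + KAR D * ((1 + rho (qlab pr m)) / N * (momSq pr / momSq (qlab pr m)))) :=
        mul_le_mul_of_nonneg_left (add_le_add hH hR) hW
    _ = (72 * D * KB D + KAR D) * ((1 + rho (qlab pr m)) / N * (WS (qlab pr m) * (momSq pr / momSq (qlab pr m)))) := by ring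

end Collapse

end Summit.QuantumFields.BalabanUV.Beta.GAN24.FineReadoutCauchyMatchedRate

end
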